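import Summits.BirchSwinnertonDyer.BirchSwinnertonDyer.Theorems.ByReductionTypeAtTwoMultLowerHalfDescent
import Summits.BirchSwinnertonDyer.BirchSwinnertonDyer.Theses.ByReductionTypeAtTwo
import HarnessLib

/-!
# Route `ByReductionTypeAtTwo`, items 19923 `MultLowerHalfAtTwo` / 19922 `MultUpperHalfAtTwo` — DICTIONARY LEAF (import refactor H4)

The three route-decl dictionary theorems formerly §4 of `Theorems/ByReductionTypeAtTwoMultLowerHalfDescent.lean` (seat `bsd-2adic-mult-3`),
moved here VERBATIM so that the descent hub module is route-free (director-bsd 2026-08-26 standing build rule: only an item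
closer / load-bearing leaf imports a `…Theses.<Route>` file). This leaf IS such a file: it states `MultLowerHalfAtTwo` /
`MultUpperHalfAtTwo` in descent currency. Nothing is booked; no mathematical change; research route (cell `bsd-2adic`).
[cite: Miller2011LMS, Def. 1.1] [cite: Cassels1998, §1]
-/

set_option autoImplicit false
-- the route's Theorems namespace repeats a component by design (summit = sub-problem, D-0017).
set_option linter.dupNamespace false

noncomputable section

open scoped Classical MatrixGroups ModularForm

open CongruenceSubgroup WeierstrassCurve Literature.NumberTheory.EllipticCurves
  Literature.NumberTheory.EllipticCurves.ModularForms
  Literature.NumberTheory.EllipticCurves.Greenberg1999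
  Literature.NumberTheory.EllipticCurves.Rank1Residual
  Literature.NumberTheory.EllipticCurves.Rank1Residual.Typed
  Summit.BirchSwinnertonDyer.Rank1Residual
  Summit.BirchSwinnertonDyer.Rank1Residual.X5

namespace Summit.BirchSwinnertonDyer.BirchSwinnertonDyer.Theorems

/-! ## §4 Dictionary: the route decl in descent currency; S1 gives both halves -/

/-- **Item 19923 `MultLowerHalfAtTwo` ⟺ «every non-CM `W` of analytic rank `0`, multiplicative at `2`,
carries a level datum `2^m ∣ #Ш(W)` with `ord₂ #Ш_an(W) ≤ m`»** (GZK for finiteness in ⇐). So the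
∀-statement is the ∀-closure of a per-curve FINITE CERTIFICATE — decided by published descent
algorithms on 1 965/1 969 census classes, unbounded in level (K = 4 classes exist) — and equally the
Eisenstein direction of the 2-adic IMC at a multiplicative `2` on the Kato–Néron road (GEN 0,
`X5.O1.missingLowerBoundAt_iff_mainConjecture_{nonsplit,split}_two`). A dictionary, no claim.
[cite: Miller2011LMS, Def. 1.1] [cite: Cassels1998, §1] -/
theorem multLowerHalfAtTwo_iff_forall_pow_dvd (hGZK : rank_eq_analyticRank_of_analyticRank_le_one) :
    Summit.BirchSwinnertonDyer.BirchSwinnertonDyer.Theses.ByReductionTypeAtTwo.MultLowerHalfAtTwo ↔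
      ∀ (W : WeierstrassCurve ℚ) [W.IsElliptic] [W.IsGloballyMinimal], ¬ W.HasCM →
        W.analyticRank = 0 → Mult W 2 →
        ∃ (q : ℚ) (m : ℕ), shaAn W = (q : ℂ) ∧ padicValRat 2 q ≤ m ∧ 2 ^ m ∣ W.shaOrder := by
  haveI : Fact (Nat.Prime 2) := ⟨Nat.prime_two⟩
  unfold Summit.BirchSwinnertonDyer.BirchSwinnertonDyer.Theses.ByReductionTypeAtTwo.MultLowerHalfAtTwo
  constructor
  · intro h W _ _ hcm hr hmult
    exact exists_pow_dvd_of_missingLowerBoundAt W 2 (h W hcm hr hmult)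
  · intro h W _ _ hcm hr hmult
    obtain ⟨q, m, hq, hv, hdvd⟩ := h W hcm hr hmult
    exact missingLowerBoundAt_of_rankZero_of_pow_dvd W 2 hGZK hr hq hv hdvd

/-- **The ONE-MEMBER form of the item** (GZK, Cassels, modularity): `MultLowerHalfAtTwo` ⟺ every such
`W` is `ℚ`-isogenous to SOME globally minimal `W₂` carrying a level datum. This is the census reading:
one certified member per class. [cite: Cassels1965ArithmeticVIII] [cite: Miller2011LMS, Def. 1.1] -/
theorem multLowerHalfAtTwo_iff_forall_exists_levelMember
    (hGZK : rank_eq_analyticRank_of_analyticRank_le_one) (hCassels : bsdRHS_eq_of_isIsogenous)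
    (hL : hasEntireLFunction_rat) :
    Summit.BirchSwinnertonDyer.BirchSwinnertonDyer.Theses.ByReductionTypeAtTwo.MultLowerHalfAtTwo ↔
      ∀ (W : WeierstrassCurve ℚ) [W.IsElliptic] [W.IsGloballyMinimal], ¬ W.HasCM →
        W.analyticRank = 0 → Mult W 2 →
        ∃ (W₂ : WeierstrassCurve ℚ) (_ : W₂.IsElliptic) (_ : W₂.IsGloballyMinimal),
          IsIsogenous W W₂ ∧ ∃ (q : ℚ) (m : ℕ), shaAn W₂ = (q : ℂ) ∧ padicValRat 2 q ≤ m ∧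
            2 ^ m ∣ W₂.shaOrder := by
  haveI : Fact (Nat.Prime 2) := ⟨Nat.prime_two⟩
  constructor
  · intro h W iE iM hcm hr hmult
    obtain ⟨q, m, hq, hv, hdvd⟩ :=
      exists_pow_dvd_of_missingLowerBoundAt W 2 (h W hcm hr hmult)
    exact ⟨W, iE, iM, IsIsogenous.refl_holds W, q, m, hq, hv, hdvd⟩
  · intro h W _ _ hcm hr hmult
    obtain ⟨W₂, iE, iM, hiso, q, m, hq, hv, hdvd⟩ := h W hcm hr hmult
    exact missingLowerBoundAt_two_of_levelMember hGZK hCassels hL W hr W₂ hiso hq hv hdvd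

/-- **S1 gives both halves.** The X5 descent route's per-curve datum `X5.DescentCertificateAt W`
(sha-1: a level `k`, `Ш[2^{k+1}] = Ш[2^k]`, `#Ш[2^k] = 2^m`, `ord₂ #Ш_an = m`) IS Miller's last clause
(`X5.missingInputAt_of_descentCertificateAt`), hence yields the lower half 19923 AND the upper half
19922 at `W`; its ∀-closure over the multiplicative rank-0 class (TARGET §1.6 «S1») therefore implies
both items. The census says where S1's instance stands today (K = 2: exact on 1 854 reps; K = 3: lower
only). [cite: Miller2011LMS, Def. 1.1] [cite: Cassels1998, §1] -/
theorem multHalves_of_forall_descentCertificateAt (hGZK : rank_eq_analyticRank_of_analyticRank_le_one)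
    (hS1 : ∀ (W : WeierstrassCurve ℚ) [W.IsElliptic] [W.IsGloballyMinimal], ¬ W.HasCM →
      W.analyticRank = 0 → Mult W 2 → X5.DescentCertificateAt W) :
    Summit.BirchSwinnertonDyer.BirchSwinnertonDyer.Theses.ByReductionTypeAtTwo.MultLowerHalfAtTwo ∧
      Summit.BirchSwinnertonDyer.BirchSwinnertonDyer.Theses.ByReductionTypeAtTwo.MultUpperHalfAtTwo := by
  haveI : Fact (Nat.Prime 2) := ⟨Nat.prime_two⟩
  unfold Summit.BirchSwinnertonDyer.BirchSwinnertonDyer.Theses.ByReductionTypeAtTwo.MultLowerHalfAtTwo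
    Summit.BirchSwinnertonDyer.BirchSwinnertonDyer.Theses.ByReductionTypeAtTwo.MultUpperHalfAtTwo
  have key : ∀ (W : WeierstrassCurve ℚ) [W.IsElliptic] [W.IsGloballyMinimal], ¬ W.HasCM →
      W.analyticRank = 0 → Mult W 2 → MissingLowerBoundAt W 2 ∧ MissingUpperBoundAt W 2 := by
    intro W _ _ hcm hr hmult
    have hfin : W.ShaFinite := (hGZK W (by omega)).2
    exact lower_and_upper_of_missingPPartAt W 2
      (X5.missingInputAt_of_descentCertificateAt W hfin (hS1 W hcm hr hmult))
  exact ⟨fun W _ _ hcm hr hmult => (key W hcm hr hmult).1,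
    fun W _ _ hcm hr hmult => (key W hcm hr hmult).2⟩

end Summit.BirchSwinnertonDyer.BirchSwinnertonDyer.Theorems

end
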